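import Summits.CriticalPhenomena.Ising3DConformalLimit.Theorems.RotationUpgradeFromTwoPoint.Negative.AutomaticOrders
import Summits.CriticalPhenomena.Ising3DConformalLimit.Theorems.MoebiusLimitExists.Negative.MeshContinuity

/-!
# Skeleton of line `null-laplacian-edge-gaussianity` for crux `RotationUpgradeFromTwoPoint`
(item stmt-CriticalPhenomena-8367; route `GaussianScaleMixture`, decl
`Summit.CriticalPhenomena.Ising3DConformalLimit.Theses.GaussianScaleMixture.RotationUpgradeFromTwoPoint`)

Crux (FIXED; concluded BY NAME below by `RotationUpgradeFromTwoPoint_of`): for every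
`(ρ, Δ, S)` with (H1) `ρ > 0` on `(0,1]`, (H2) `HasPointwiseScalingLimit (criticalCorr 3) ρ S`,
(H3) `S = 0` off `NonCoincident`, (H4) non-degenerate `S₂`, (H5) translation invariance,
(H6) scale covariance with `Δ`, (H7) two-point isotropy, the family `S` is `IsRotationInvariant`.

## The line (idea card `Ideas/null-laplacian-edge-gaussianity.md`, triage r1: pass ×3)

STRATIFY the crux by the Aizenman–Newman dichotomy (`U₄ ≡ 0` / `HasNontrivialU4 S`) and by
the pinned window `Δ ∈ [1/2, 1]` (`delta_mem_Icc_of_hyp`, landed Negative/AutomaticOrders).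

* GAUSSIAN locus `U₄ ≡ 0`: closed by the landed theorem `isRotationInvariant_of_gaussian`
  (Negative/AutomaticOrders; Wick at all even orders of the round `S₂`). Nothing to do.
* EDGE `Δ = 1/2` (`η = 0`): the idea's LEVER. At the edge the round kernel `S₂ = c‖x-y‖⁻¹`
  handed over by (H7)+(H6) is HARMONIC off the diagonal, so in the Osterwalder–Schrader space of
  each of the NINE lattice pictures (stub 1) the centred spherical mean of the one-point vector,
  `⨍_{S(x,r)} [Z(a)] dσ(a) - [Z(x)]`, is an exact NULL VECTOR (`‖·‖² = (⨍⨍ - 2⨍ + 1) c‖θa-b‖⁻¹ = 0`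
  by the mean-value property of `1/r` in each slot) — an identity manufactured by reflection
  positivity; pairing it with `[∏ Z(yᵢ)]` (Cauchy–Schwarz) gives the mean-value property, hence
  harmonicity, of `x ↦ S_{m+1}(x, Y)` wherever a lattice mirror separates `x` from `Y`
  (stub 2, `stub_exteriorHarmonic`). The nine pictures make `S_{m+1}(·, Y)` real-analytic off
  `Y ∪ F` with `F` FINITE (stub 3, `stub_analyticOffFinite`, valid for EVERY `Δ`: two-cluster OS
  semigroup holomorphy in two spanning directions of the `(t,s)`-plane + Bernstein's separate
  analyticity theorem; any five of the nine normals span `ℝ³`, so a point with fewer than three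
  independent "good" directions lies on three independent planes `n·x = n·yᵢ`), so harmonicity
  floods `ℝ³ ∖ Y` (identity theorem + removable bounded singularities); the limit inequalities
  GKS-II (below, one pairing) and Lebowitz (above, `U₄ ≤ 0`) make `U₄(·, Y) = S₄ - Wick₄` a
  BOUNDED harmonic function near each `yᵢ`, hence entire, tending to `0` at infinity: `U₄ ≡ 0`
  by Liouville (stub 4, `stub_edgeBocherLiouville`). So an edge instance is Gaussian — which
  contradicts the non-Gaussian branch: on that branch `Δ > 1/2` (dividend
  `nonGaussian_forces_eta_of_stubs`: "interaction forces an anomalous dimension", rotation-free).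
* INTERIOR `1/2 < Δ ≤ 1`, `U₄ ≢ 0` (the physical point `Δ_σ ≈ 0.518`, `U₄ < 0`): ONE named
  GRAFT stub `stub_interiorRotationUpgrade`, stated WITH everything this line manufactures for
  free (nine-mirror OS positivity of all orders, the all-`Δ` analyticity layer, `η > 0`,
  `U₄ ≢ 0`, the window). No mechanism is claimed there by this line (see the line card, "Graft").

`RotationUpgradeFromTwoPoint_of` is hypothesis-free and kernel-checked: the only `sorry`s of
this file are the five `stub_*` bodies, fed to the pure-logic lemma `crux_of_stubs`.

## Disproof used (`Cruxes/RotationUpgradeFromTwoPoint/Disproof.lean` v3, cdisprove cycle 1; landed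
`Theorems/RotationUpgradeFromTwoPoint/Negative/{AutomaticOrders, NondegeneracyRedundant,
CubicDecoy, CubicDecoySymmetries, CoincidentDecoration}` — `AutomaticOrders` is IMPORTED and USED
here; `NondegeneracyRedundant.limit_nonneg` (Griffiths I in the limit) and the decoy files are cited
by name in the stub docstrings (not imported: the farm had not rebuilt them at planning time))
* `crux_iff_evenFromFour` / `isRotationInvariant_of_gaussian` / `rotationInvariant_or_nontrivialU4`:
  orders `0, 2`, odd and the whole Gaussian alternative are CONSUMED in `crux_of_stubs` (landed
  theorem, by name); the stubs only ever work on the non-Gaussian branch or produce `U₄ ≡ 0`.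
* `not_cruxWithoutIsingLimit` / `not_cruxWithCubicLatticeLimit` ((H2) load-bearing; "a proof must
  use a property `cubicFamily Δ` lacks"): HONOURED — every stub keeps (H2), and the lever is
  nine-mirror OS positivity of ALL orders (stub 1), which the decoy lacks
  (`cubicFamily_not_reflectionPositive`); the decoy's `S₄(·, Y) = Wick - bump·aniso` at `Δ = 1/2`
  is NOT harmonic off `Y` (triage r1-2 check (B): `Δ_x[bump·aniso] = -1.7e-5 ≠ 0` at `x = 10e₃`,
  `Y = {0,e₁,e₂}`), so stub 2's conclusion fails for it, as it must.
* `not_cruxWithoutNormalisation` ((H3) load-bearing): (H3) is kept in every stub and USED (rows of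
  non-injective clusters vanish in stub 1; `S = 0` off `NonCoincident` in the Gaussian branch).
* `delta_mem_Icc` (= landed `delta_mem_Icc_of_hyp`): drives the case split; `Δ ≤ 1` handed to stub 5.
* `two_point_law` (landed): `S₂(a,b) = ‖a-b‖^{-2Δ} S₂(0,e₀)`, at the edge `c‖a-b‖⁻¹` — the
  harmonic kernel of stub 2 and the Wick part of stub 4.
* §4 `rpCubicDecoy` (OPEN nine-mirror RP cubic decoy): DENTED at the edge — by stubs 2–4 no RP
  family with round HARMONIC `S₂`, `S ≥ 0`, GKS-II₄ and Lebowitz₄ can have `U₄ ≢ 0`, so any such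
  decoy has `Δ > 1/2`; for `Δ > 1/2` it stays open and is exactly why stub 5 keeps (H2).
* Negatives index (`ledger negatives --problem CriticalPhenomena`): SAW / percolation / Cardy items
  only; nothing refuted is restated by any stub.
-/

noncomputable section

open Filter Topology
open Literature.Probability.LatticeModels
open Summit.CriticalPhenomena.Ising3DConformalLimit.RotationUpgradeFromTwoPointNegative
  (isRotationInvariant_of_gaussian delta_mem_Icc_of_hyp)

namespace Summit.CriticalPhenomena.Ising3DConformalLimit.Cruxes.RotationUpgradeFromTwoPoint.NullLaplacianEdgeGaussianity

/-! ### The five registered stubs (def-free signatures over tree declarations)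

Conventions used verbatim in every signature (so that the composition is by `exact`):
* a LATTICE NORMAL is `n = eᵢ`, `eᵢ + eⱼ` or `eᵢ - eⱼ` (`i ≠ j`; the nine mirror normals of
  `GSMRigidity` / `TwoPointKernelOfLimit`), the mirror is `((ℝ ∙ n)ᗮ).reflection`;
* NINE-MIRROR OS POSITIVITY of `S` (all orders): for finitely many clusters `A a : Fin (m a) → ℝ³`
  in the OPEN half-space `{x | 0 < ⟪x, n⟫}` and reals `c a`,
  `0 ≤ ∑ a b, c a c b S (m a + m b) (θ_n (A a) ++ A b)`;
* `x` is SEPARATED from `y : Fin m → ℝ³` by the mirror family of `n` when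
  `⟪x,n⟫ < ⟪yᵢ,n⟫ ∀ i` or `⟪yᵢ,n⟫ < ⟪x,n⟫ ∀ i`.
-/

/-- **STUB 1 (M/L, lattice → limit; shared infrastructure) — `stub_nineMirrorRP`.**
Nine-mirror Osterwalder–Schrader positivity of ALL orders for every normalised,
translation-invariant pointwise scaling limit `S` of `criticalCorr 3` (`ρ > 0` on `(0,1]`): for
each of the nine lattice normals `n ∈ {eᵢ, eᵢ + eⱼ, eᵢ - eⱼ}`, every finite family of clusters
`A a` in the open half-space `{0 < ⟪x, n⟫}` and reals `c a`, the Gram sum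
`∑_{a,b} c_a c_b S(θ_n A_a ⊔ A_b)` is `≥ 0`. Intended proof (Fröhlich–Israel–Lieb–Simon site-plane
RP, FILS 1978 §2–3, for the THREE kinds of planes `{k_i = 0}`, `{k_i = k_j}`, `{k_i + k_j = 0}` of
`ℤ³` — no n.n. bond crosses any of them strictly — via the tree theorem
`isingExpect_free_reflect_mul_self_nonneg` (general involutive graph automorphism in FILS site
position; centred boxes are stable under all three), free box limits =
`criticalCorr_wellDefined_holds`, exactly as the LANDED coordinate case
`FreeEndpointGaussianClosure.stub_latticeRP` (Theorems/HyperoctahedralRPInversionUpgradeNormalisedLatticeRP);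
then passage to the limit as in `FreeEndpointGaussianClosure.stub_osReflectionPositive`: for the
anti-diagonal normal `eᵢ - eⱼ` the mesh map `⌊·/δ⌋` commutes with the mirror EXACTLY (coordinate
swap); for `eᵢ` use the half-mesh shift `z ↦ z + (δ/2)eᵢ`, for `eᵢ + eⱼ` the shift
`z ↦ z + (δ/2)(eᵢ + eⱼ)` (then `⌊-t + 1/2⌋ = -⌊t + 1/2⌋` off a countable set of `δ`, and `S` is
blind to the shift by translation invariance); clusters with a repeated point contribute zero
rows and columns by (H3), injective ones have injective lattice images for small `δ`; locally
uniform convergence at the (open) non-coincident Gram configurations, `ge_of_tendsto`.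
[cite: FrohlichIsraelLiebSimon1978, §2–3; GlimmJaffe1987, §6.1 (OS3); FriedliVelenik2017, Lemma 10.8] -/
theorem stub_nineMirrorRP :
    ∀ (ρ : ℝ → ℝ) (S : CorrFamily 3), (∀ δ ∈ Set.Ioc (0:ℝ) 1, 0 < ρ δ) →
      HasPointwiseScalingLimit (criticalCorr 3) ρ S →
      (∀ n z, z ∉ NonCoincident 3 n → S n z = 0) → IsTranslationInvariant S →
      ∀ n : EuclideanSpace ℝ (Fin 3),
        (∃ i j : Fin 3, i ≠ j ∧ (n = EuclideanSpace.single i 1 ∨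
          n = EuclideanSpace.single i 1 + EuclideanSpace.single j 1 ∨
          n = EuclideanSpace.single i 1 - EuclideanSpace.single j 1)) →
        ∀ (k : ℕ) (m : Fin k → ℕ) (A : (a : Fin k) → Fin (m a) → EuclideanSpace ℝ (Fin 3))
          (c : Fin k → ℝ), (∀ a i, 0 < inner ℝ (A a i) n) →
          0 ≤ ∑ a, ∑ b, c a * c b *
            S (m a + m b) (Fin.append (fun i => ((ℝ ∙ n)ᗮ).reflection (A a i)) (A b)) := by
  sorry

/-- **STUB 2 (L; THE LEVER, edge only) — `stub_exteriorHarmonic`.**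
Under the crux hypotheses with `Δ = 1/2` and nine-mirror OS positivity of all orders (STUB 1),
for every injective `y : Fin m → ℝ³`, every lattice normal `n` and every `u` separated from `y`
by the mirror family of `n`, the function `x ↦ S_{m+1}(x, y)` is HARMONIC at `u`
(`InnerProductSpace.HarmonicAt`: `C²` near `u` and Laplacian `0` near `u`). Intended proof (no
field operators, no distributions): WLOG (translation invariance) the mirror `{⟪x,n⟫ = 0}` has
`u` strictly below and `y` strictly above. For `x'` above put `g(x') := S_{m+1}(θ_n x', y)`.
(i) `g` is continuous (the configuration is non-coincident; `LimitMeshContinuity.continuousOn_limit`).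
(ii) MEAN-VALUE PROPERTY: by `two_point_law` at `Δ = 1/2`, the one-point Gram kernel of picture
`n` is `k(a,b) = S₂(θa, b) = c‖θa - b‖⁻¹`, harmonic in each slot on the open half-space (pole on
the other side); for quadrature weights `w_j ≥ 0`, `∑ w_j = 1`, nodes `a_j` on the sphere
`S(x',r)` (closed ball inside the half-space) the formal vector `v = ∑ w_j [a_j] - [x']` has
`⟪v,v⟫_OS = ∑ w_j w_l k(a_j,a_l) - 2∑ w_j k(a_j,x') + k(x',x') → ⨍⨍k - 2⨍k + k = 0` (mean value
of `1/r` in each slot), and STUB 1 with the clusters `{a_j}, {x'}, y` gives Cauchy–Schwarz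
`|∑ w_j g(a_j) - g(x')|² ≤ ⟪v,v⟫_OS · S_{2m}(θy ⊔ y) → 0`, i.e. `g(x') = ⨍_{S(x',r)} g dσ`.
(iii) continuous + spherical mean-value property on all small spheres ⇒ harmonic (converse of
Gauss' theorem, via radial mollification); `x ↦ S_{m+1}(x,y) = g(θ_n x)` is harmonic below the
mirror (`θ_n` is a linear isometry). The RP cubic decoy test: `cubicFamily (1/2)` fails the
conclusion (its `S₄(·,Y)` has `Δ_x ≠ 0` off the hull) precisely because it is not RP.
[cite: GlimmJaffe1987, §6.1 Prop. 6.1.1; AxlerBourdonRamey2001, Ch. 1 (mean-value property of harmonic functions and its converse)] -/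
theorem stub_exteriorHarmonic :
    ∀ (ρ : ℝ → ℝ) (Δ : ℝ) (S : CorrFamily 3), (∀ δ ∈ Set.Ioc (0:ℝ) 1, 0 < ρ δ) →
      HasPointwiseScalingLimit (criticalCorr 3) ρ S →
      (∀ n z, z ∉ NonCoincident 3 n → S n z = 0) → IsNondegenerateTwoPoint S →
      IsTranslationInvariant S → IsScaleCovariant Δ S →
      (∀ (R : EuclideanSpace ℝ (Fin 3) ≃ₗᵢ[ℝ] EuclideanSpace ℝ (Fin 3))
        (x : EuclideanSpace ℝ (Fin 3)), x ≠ 0 → S 2 ![0, R x] = S 2 ![0, x]) →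
      (∀ n : EuclideanSpace ℝ (Fin 3),
        (∃ i j : Fin 3, i ≠ j ∧ (n = EuclideanSpace.single i 1 ∨
          n = EuclideanSpace.single i 1 + EuclideanSpace.single j 1 ∨
          n = EuclideanSpace.single i 1 - EuclideanSpace.single j 1)) →
        ∀ (k : ℕ) (m : Fin k → ℕ) (A : (a : Fin k) → Fin (m a) → EuclideanSpace ℝ (Fin 3))
          (c : Fin k → ℝ), (∀ a i, 0 < inner ℝ (A a i) n) →
          0 ≤ ∑ a, ∑ b, c a * c b *
            S (m a + m b) (Fin.append (fun i => ((ℝ ∙ n)ᗮ).reflection (A a i)) (A b))) →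
      Δ = 1 / 2 →
      ∀ (m : ℕ) (y : Fin m → EuclideanSpace ℝ (Fin 3)), Function.Injective y →
        ∀ n : EuclideanSpace ℝ (Fin 3),
          (∃ i j : Fin 3, i ≠ j ∧ (n = EuclideanSpace.single i 1 ∨
            n = EuclideanSpace.single i 1 + EuclideanSpace.single j 1 ∨
            n = EuclideanSpace.single i 1 - EuclideanSpace.single j 1)) →
          ∀ u : EuclideanSpace ℝ (Fin 3),
            ((∀ i, inner ℝ u n < inner ℝ (y i) n) ∨ (∀ i, inner ℝ (y i) n < inner ℝ u n)) →
            InnerProductSpace.HarmonicAt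
              (fun x : EuclideanSpace ℝ (Fin 3) => S (m + 1) (Fin.cons x y)) u := by
  sorry

/-- **STUB 3 (XL; the reusable regularity layer, valid for EVERY `Δ`) — `stub_analyticOffFinite`.**
For every normalised, translation-invariant pointwise scaling limit `S` of `criticalCorr 3`
(`ρ > 0` on `(0,1]`) with nine-mirror OS positivity of all orders (STUB 1), and every injective
`y : Fin m → ℝ³`, the function `x ↦ S_{m+1}(x, y)` is REAL-ANALYTIC off `range y ∪ F` for some
FINITE set `F`. Intended proof. A lattice normal `n` is GOOD at `x` when `⟪x,n⟫ ∉ {⟪yᵢ,n⟫}`;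
split `y` into `y_<`, `y_>` along `n`. (a) Mirror strictly between `y_<` and `{x} ∪ y_>`: OS
reconstruction in picture `n` (RP of STUB 1 + translation invariance + continuity of `S`
(`LimitMeshContinuity.continuousOn_limit`) + Gaussian-domination growth, or Klein–Landau's
symmetric local semigroup theorem) gives a self-adjoint contraction semigroup `e^{-tH}`, so
`r ↦ S(y_<, ({x} ⊔ y_>) + r n) = ⟪[θy_<], e^{-(r₀+r)H}[B']⟫` is real-analytic near `0` with a
holomorphic extension to `|r| < r₀` bounded by `‖[θy_<]‖‖[B']‖` (`r₀` = half the gap);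
(b) mirror between `{x} ∪ y_<` and `y_>`: likewise `s ↦ S(y_<, x, y_> + s n)`. The two directions
`(1,1)` and `(0,1)` span the `(t,s)`-plane of `h(t,s) = S(y_<, x + t n, y_> + s n)`, with locally
uniform radii and bounds, so BERNSTEIN's separate-analyticity theorem (Chebyshev coefficients +
two-constants interpolation) makes `h` jointly real-analytic near `0`, hence `t ↦ S(x + t n, y)`
real-analytic. (c) Three linearly independent good directions at `x` ⇒ (Bernstein again, three
variables) joint real-analyticity near `x`. (d) COUNT: the largest subset of the nine normals
lying in a plane has four elements (a `B₂` quadruple), so fewer than three independent good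
directions forces at least five bad ones, and any five of the nine span `ℝ³`: `x` lies on three
independent planes `⟪x,n⟫ = ⟪yᵢ,n⟫`, a finite set `F` (`|F| ≤ C(9m, 3)`). With the three
coordinate pictures only, the bad set is a union of planes disconnecting `ℝ³ ∖ y` — the
anisotropic coordinate-RP long-range Gaussian limits (`LongRangeTrivialityOnZ3`) show the nine
are needed downstream. [cite: OsterwalderSchrader1975, §4; GlimmJaffe1987, §6.1 Thm. 6.1.3; KleinLandau1981JFA, main theorem (unique self-adjoint generator of a symmetric local semigroup); JarnickiPflug2011, Ch. 1 (Bernstein's theorem on separately real-analytic functions with uniform estimates)] -/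
theorem stub_analyticOffFinite :
    ∀ (ρ : ℝ → ℝ) (S : CorrFamily 3), (∀ δ ∈ Set.Ioc (0:ℝ) 1, 0 < ρ δ) →
      HasPointwiseScalingLimit (criticalCorr 3) ρ S →
      (∀ n z, z ∉ NonCoincident 3 n → S n z = 0) → IsTranslationInvariant S →
      (∀ n : EuclideanSpace ℝ (Fin 3),
        (∃ i j : Fin 3, i ≠ j ∧ (n = EuclideanSpace.single i 1 ∨
          n = EuclideanSpace.single i 1 + EuclideanSpace.single j 1 ∨
          n = EuclideanSpace.single i 1 - EuclideanSpace.single j 1)) →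
        ∀ (k : ℕ) (m : Fin k → ℕ) (A : (a : Fin k) → Fin (m a) → EuclideanSpace ℝ (Fin 3))
          (c : Fin k → ℝ), (∀ a i, 0 < inner ℝ (A a i) n) →
          0 ≤ ∑ a, ∑ b, c a * c b *
            S (m a + m b) (Fin.append (fun i => ((ℝ ∙ n)ᗮ).reflection (A a i)) (A b))) →
      ∀ (m : ℕ) (y : Fin m → EuclideanSpace ℝ (Fin 3)), Function.Injective y →
        ∃ F : Finset (EuclideanSpace ℝ (Fin 3)),
          AnalyticOnNhd ℝ (fun x : EuclideanSpace ℝ (Fin 3) => S (m + 1) (Fin.cons x y))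
            (Set.range y ∪ (F : Set (EuclideanSpace ℝ (Fin 3))))ᶜ := by
  sorry

/-- **STUB 4 (M/L; potential theory of one function of one variable) — `stub_edgeBocherLiouville`.**
Under the crux hypotheses with `Δ = 1/2`, exterior harmonicity (STUB 2 at `m = 3`) and
analyticity off a finite set (STUB 3 at `m = 3`) force `U₄ ≡ 0` on non-coincident quadruples.
Intended proof, for `z` injective, `y := (z₁,z₂,z₃)`, `f := S₄(·, y)`: (1) `Δf` is real-analytic on
the connected open set `Ω = (range y ∪ F)ᶜ` (`Set.Countable.isPathConnected_compl_of_one_lt_rank`)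
and vanishes on the non-empty open exterior (points far out along `-n`), so `Δf ≡ 0` on `Ω`
(`AnalyticOnNhd.eqOn_zero_of_preconnected_of_eventuallyEq_zero`): `f` is harmonic on `Ω`.
(2) At `p ∈ F ∖ range y`, `f` is continuous (`continuousOn_limit`), hence bounded near the isolated
singularity, hence harmonic at `p` (removable singularities of BOUNDED harmonic functions,
`d = 3`): `f` is harmonic on `ℝ³ ∖ range y`. (3) Pinning WITHOUT Bôcher: by `two_point_law`,
`S₂(a,b) = c‖a-b‖⁻¹` (`c = S₂(0,e₀) > 0`), so the Wick part `W(x) = Σ_pairings` is harmonic in `x`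
off `y`; GKS-II in the limit (one pairing below: `S₂(x,yᵢ)S₂(yⱼ,y_k) ≤ S₄`, tree
`rescaledCorrelator_split_le` + slot symmetry + `le_of_tendsto_of_tendsto'`) and Lebowitz in the
limit (`limitConnectedFour_nonpos_of_hasPointwiseScalingLimit`: `S₄ ≤ W`) give
`-(the two pairings regular at yᵢ) ≤ U := f - W ≤ 0` near each `yᵢ`: `U` is harmonic on `ℝ³ ∖ y`
and BOUNDED near each `yᵢ`, hence (removability again) entire harmonic, and `|U| ≤ W → 0` at
infinity: `U` is bounded on `ℝ³`, constant by Liouville, and the constant is `0`. So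
`limitConnectedFour S z = U(z₀) = 0`. (A Gaussian SCALE MIXTURE — RP, round, `Δ = 1/2`, `U₄ ≥ 0`
— is excluded exactly by the Lebowitz sign: the lattice hypothesis is used.)
[cite: AxlerBourdonRamey2001, Ch. 2 (Liouville's theorem; isolated singularities of bounded harmonic functions); AizenmanCMP1982, §5 (Lebowitz inequality U₄ ≤ 0); FriedliVelenik2017, Thm. 3.20 (GKS II)] -/
theorem stub_edgeBocherLiouville :
    ∀ (ρ : ℝ → ℝ) (Δ : ℝ) (S : CorrFamily 3), (∀ δ ∈ Set.Ioc (0:ℝ) 1, 0 < ρ δ) →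
      HasPointwiseScalingLimit (criticalCorr 3) ρ S →
      (∀ n z, z ∉ NonCoincident 3 n → S n z = 0) → IsNondegenerateTwoPoint S →
      IsTranslationInvariant S → IsScaleCovariant Δ S →
      (∀ (R : EuclideanSpace ℝ (Fin 3) ≃ₗᵢ[ℝ] EuclideanSpace ℝ (Fin 3))
        (x : EuclideanSpace ℝ (Fin 3)), x ≠ 0 → S 2 ![0, R x] = S 2 ![0, x]) →
      Δ = 1 / 2 →
      (∀ (y : Fin 3 → EuclideanSpace ℝ (Fin 3)), Function.Injective y →
        ∀ n : EuclideanSpace ℝ (Fin 3),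
          (∃ i j : Fin 3, i ≠ j ∧ (n = EuclideanSpace.single i 1 ∨
            n = EuclideanSpace.single i 1 + EuclideanSpace.single j 1 ∨
            n = EuclideanSpace.single i 1 - EuclideanSpace.single j 1)) →
          ∀ u : EuclideanSpace ℝ (Fin 3),
            ((∀ i, inner ℝ u n < inner ℝ (y i) n) ∨ (∀ i, inner ℝ (y i) n < inner ℝ u n)) →
            InnerProductSpace.HarmonicAt
              (fun x : EuclideanSpace ℝ (Fin 3) => S (3 + 1) (Fin.cons x y)) u) →
      (∀ (y : Fin 3 → EuclideanSpace ℝ (Fin 3)), Function.Injective y →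
        ∃ F : Finset (EuclideanSpace ℝ (Fin 3)),
          AnalyticOnNhd ℝ (fun x : EuclideanSpace ℝ (Fin 3) => S (3 + 1) (Fin.cons x y))
            (Set.range y ∪ (F : Set (EuclideanSpace ℝ (Fin 3))))ᶜ) →
      ∀ z ∈ NonCoincident 3 4, limitConnectedFour S z = 0 := by
  sorry

/-- **STUB 5 (XXL = the crux on its physical stratum; GRAFT POINT, held by the lead) —
`stub_interiorRotationUpgrade`.** The crux restricted to the NON-GAUSSIAN INTERIOR
`1/2 < Δ ≤ 1`, `U₄ ≢ 0` (`Δ_σ ≈ 0.5181`, `U₄ < 0`), stated WITH the structure this line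
manufactures at zero cost: nine-mirror OS positivity of all orders (STUB 1) and joint
real-analyticity of every `S_{m+1}(·, y)` off a finite set (STUB 3). No mechanism is claimed
here. Why the edge lever stops: for `Δ > 1/2` the one-particle Källén–Lehmann weight
`(E² - p²)^{Δ-3/2}` of the round generalised free field has SOLID support, so no local null vector
`[P(∂)Z]` exists in any picture, and the round two-point law is shared by non-Gaussian RP theories
(GFF non-uniqueness, barrier `TwoPointLawNotMoebius`); an identity must come from elsewhere.
Typed ways to fill it: (i) an inversion-first upgrade (landed `crux_of_inversionUpgrade`,
Negative/AutomaticOrders: a ROTATION-FREE inversion upgrade "(H1)–(H7) ⇒ IsInversionCovariant Δ S"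
implies the crux, tree `isRotationInvariant_of_inversion`) — NB stronger than the sibling crux
`InversionUpgradeNormalised` (stmt-1982), which assumes Euclidean invariance, so a proof of
stmt-1982 feeds this stub only if it never uses rotations beyond (H7); (ii) the common conjecture MB9⁺/C⁺ of
cards rp-lebowitz-anisotropy-bootstrap / nine-mirror-crossing-pincer (nine-RP ∧ O_h ∧ round `S₂`
∧ Ising signs ⇒ O(3)) by an analytic spectral-edge functional — its negation is the disprover's
open nine-mirror `rpCubicDecoy`, which is why (H2) is kept here; (iii) universality to one
six-fold crystal (card two-crystals-generate-so3: `⟨O, g⟩` dense). [cite: DuminilCopinICM2022, §8.1 and §8.4; PolandRychkovVichi2019, §II] -/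
theorem stub_interiorRotationUpgrade :
    ∀ (ρ : ℝ → ℝ) (Δ : ℝ) (S : CorrFamily 3), (∀ δ ∈ Set.Ioc (0:ℝ) 1, 0 < ρ δ) →
      HasPointwiseScalingLimit (criticalCorr 3) ρ S →
      (∀ n z, z ∉ NonCoincident 3 n → S n z = 0) → IsNondegenerateTwoPoint S →
      IsTranslationInvariant S → IsScaleCovariant Δ S →
      (∀ (R : EuclideanSpace ℝ (Fin 3) ≃ₗᵢ[ℝ] EuclideanSpace ℝ (Fin 3))
        (x : EuclideanSpace ℝ (Fin 3)), x ≠ 0 → S 2 ![0, R x] = S 2 ![0, x]) →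
      1 / 2 < Δ → Δ ≤ 1 → HasNontrivialU4 S →
      (∀ n : EuclideanSpace ℝ (Fin 3),
        (∃ i j : Fin 3, i ≠ j ∧ (n = EuclideanSpace.single i 1 ∨
          n = EuclideanSpace.single i 1 + EuclideanSpace.single j 1 ∨
          n = EuclideanSpace.single i 1 - EuclideanSpace.single j 1)) →
        ∀ (k : ℕ) (m : Fin k → ℕ) (A : (a : Fin k) → Fin (m a) → EuclideanSpace ℝ (Fin 3))
          (c : Fin k → ℝ), (∀ a i, 0 < inner ℝ (A a i) n) →
          0 ≤ ∑ a, ∑ b, c a * c b *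
            S (m a + m b) (Fin.append (fun i => ((ℝ ∙ n)ᗮ).reflection (A a i)) (A b))) →
      (∀ (m : ℕ) (y : Fin m → EuclideanSpace ℝ (Fin 3)), Function.Injective y →
        ∃ F : Finset (EuclideanSpace ℝ (Fin 3)),
          AnalyticOnNhd ℝ (fun x : EuclideanSpace ℝ (Fin 3) => S (m + 1) (Fin.cons x y))
            (Set.range y ∪ (F : Set (EuclideanSpace ℝ (Fin 3))))ᶜ) →
      IsRotationInvariant S := by
  sorry

/-! ### Composition: the five stubs imply the crux, BY NAME (sorry-free) -/

/-- Local alias of the crux, used ONLY as the conclusion of the pure-logic lemmas below (the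
skeleton theorem `RotationUpgradeFromTwoPoint_of` concludes the route decl by name). [folklore] -/
abbrev Crux : Prop :=
  Summit.CriticalPhenomena.Ising3DConformalLimit.Theses.GaussianScaleMixture.RotationUpgradeFromTwoPoint

/-- Shorthand (docstrings / local statements only): `n` is one of the nine lattice mirror normals. [folklore] -/
def IsLatticeNormal (n : EuclideanSpace ℝ (Fin 3)) : Prop :=
  ∃ i j : Fin 3, i ≠ j ∧ (n = EuclideanSpace.single i 1 ∨
    n = EuclideanSpace.single i 1 + EuclideanSpace.single j 1 ∨
    n = EuclideanSpace.single i 1 - EuclideanSpace.single j 1)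

/-- Shorthand: nine-mirror OS positivity of all orders (the conclusion of STUB 1 for `S`). [folklore] -/
def NineMirrorRP (S : CorrFamily 3) : Prop :=
  ∀ n : EuclideanSpace ℝ (Fin 3), IsLatticeNormal n →
    ∀ (k : ℕ) (m : Fin k → ℕ) (A : (a : Fin k) → Fin (m a) → EuclideanSpace ℝ (Fin 3))
      (c : Fin k → ℝ), (∀ a i, 0 < inner ℝ (A a i) n) →
      0 ≤ ∑ a, ∑ b, c a * c b *
        S (m a + m b) (Fin.append (fun i => ((ℝ ∙ n)ᗮ).reflection (A a i)) (A b))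

/-- Shorthand: the all-`Δ` analyticity layer (the conclusion of STUB 3 for `S`). [folklore] -/
def AnalyticOffFinite (S : CorrFamily 3) : Prop :=
  ∀ (m : ℕ) (y : Fin m → EuclideanSpace ℝ (Fin 3)), Function.Injective y →
    ∃ F : Finset (EuclideanSpace ℝ (Fin 3)),
      AnalyticOnNhd ℝ (fun x : EuclideanSpace ℝ (Fin 3) => S (m + 1) (Fin.cons x y))
        (Set.range y ∪ (F : Set (EuclideanSpace ℝ (Fin 3))))ᶜ

/-- Shorthand: the seven crux hypotheses on `(ρ, Δ, S)`, bundled. [folklore] -/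
def CruxHyp (ρ : ℝ → ℝ) (Δ : ℝ) (S : CorrFamily 3) : Prop :=
  (∀ δ ∈ Set.Ioc (0:ℝ) 1, 0 < ρ δ) ∧ HasPointwiseScalingLimit (criticalCorr 3) ρ S ∧
  (∀ n z, z ∉ NonCoincident 3 n → S n z = 0) ∧ IsNondegenerateTwoPoint S ∧
  IsTranslationInvariant S ∧ IsScaleCovariant Δ S ∧
  (∀ (R : EuclideanSpace ℝ (Fin 3) ≃ₗᵢ[ℝ] EuclideanSpace ℝ (Fin 3))
    (x : EuclideanSpace ℝ (Fin 3)), x ≠ 0 → S 2 ![0, R x] = S 2 ![0, x])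

/-- Read-back (pure currying): the crux is `∀ ρ Δ S, CruxHyp ρ Δ S → IsRotationInvariant S`. -/
theorem crux_iff : Crux ↔ ∀ ρ Δ S, CruxHyp ρ Δ S → IsRotationInvariant S := by
  constructor
  · rintro h ρ Δ S ⟨h1, h2, h3, h4, h5, h6, h7⟩
    exact h ρ Δ S h1 h2 h3 h4 h5 h6 h7
  · intro h ρ Δ S h1 h2 h3 h4 h5 h6 h7
    exact h ρ Δ S ⟨h1, h2, h3, h4, h5, h6, h7⟩

/-- **EDGE `U₄` VANISHES from STUBS 1–4** (the idea's first lemma `EdgeU4Vanishes`, now a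
consequence of four named stubs; sorry-free logic). -/
theorem edgeU4Vanishes_of_stubs
    (h1 : ∀ (ρ : ℝ → ℝ) (S : CorrFamily 3), (∀ δ ∈ Set.Ioc (0:ℝ) 1, 0 < ρ δ) →
      HasPointwiseScalingLimit (criticalCorr 3) ρ S →
      (∀ n z, z ∉ NonCoincident 3 n → S n z = 0) → IsTranslationInvariant S → NineMirrorRP S)
    (h2 : ∀ (ρ : ℝ → ℝ) (Δ : ℝ) (S : CorrFamily 3), CruxHyp ρ Δ S → NineMirrorRP S → Δ = 1 / 2 →
      ∀ (m : ℕ) (y : Fin m → EuclideanSpace ℝ (Fin 3)), Function.Injective y →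
        ∀ n : EuclideanSpace ℝ (Fin 3), IsLatticeNormal n →
          ∀ u : EuclideanSpace ℝ (Fin 3),
            ((∀ i, inner ℝ u n < inner ℝ (y i) n) ∨ (∀ i, inner ℝ (y i) n < inner ℝ u n)) →
            InnerProductSpace.HarmonicAt
              (fun x : EuclideanSpace ℝ (Fin 3) => S (m + 1) (Fin.cons x y)) u)
    (h3 : ∀ (ρ : ℝ → ℝ) (S : CorrFamily 3), (∀ δ ∈ Set.Ioc (0:ℝ) 1, 0 < ρ δ) →
      HasPointwiseScalingLimit (criticalCorr 3) ρ S →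
      (∀ n z, z ∉ NonCoincident 3 n → S n z = 0) → IsTranslationInvariant S → NineMirrorRP S →
      AnalyticOffFinite S)
    (h4 : ∀ (ρ : ℝ → ℝ) (Δ : ℝ) (S : CorrFamily 3), CruxHyp ρ Δ S → Δ = 1 / 2 →
      (∀ (y : Fin 3 → EuclideanSpace ℝ (Fin 3)), Function.Injective y →
        ∀ n : EuclideanSpace ℝ (Fin 3), IsLatticeNormal n →
          ∀ u : EuclideanSpace ℝ (Fin 3),
            ((∀ i, inner ℝ u n < inner ℝ (y i) n) ∨ (∀ i, inner ℝ (y i) n < inner ℝ u n)) →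
            InnerProductSpace.HarmonicAt
              (fun x : EuclideanSpace ℝ (Fin 3) => S (3 + 1) (Fin.cons x y)) u) →
      (∀ (y : Fin 3 → EuclideanSpace ℝ (Fin 3)), Function.Injective y →
        ∃ F : Finset (EuclideanSpace ℝ (Fin 3)),
          AnalyticOnNhd ℝ (fun x : EuclideanSpace ℝ (Fin 3) => S (3 + 1) (Fin.cons x y))
            (Set.range y ∪ (F : Set (EuclideanSpace ℝ (Fin 3))))ᶜ) →
      ∀ z ∈ NonCoincident 3 4, limitConnectedFour S z = 0)
    {ρ : ℝ → ℝ} {Δ : ℝ} {S : CorrFamily 3} (hS : CruxHyp ρ Δ S) (hΔ : Δ = 1 / 2) :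
    ∀ z ∈ NonCoincident 3 4, limitConnectedFour S z = 0 := by
  obtain ⟨hρ, hlim, hnorm, _, htr, _, _⟩ := id hS
  have hRP : NineMirrorRP S := h1 ρ S hρ hlim hnorm htr
  have han : AnalyticOffFinite S := h3 ρ S hρ hlim hnorm htr hRP
  exact h4 ρ Δ S hS hΔ (fun y hy => h2 ρ Δ S hS hRP hΔ 3 y hy) (fun y hy => han 3 y hy)

/-- **"Interaction forces an anomalous dimension"** — the rotation-free DIVIDEND of STUBS 1–4
(sorry-free logic): a non-Gaussian instance of the crux hypotheses has `Δ > 1/2` (`η > 0`).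
On route GaussianScaleMixture item (E) `IsingEuclidUpgradeR4NonGaussian` supplies `U₄ ≢ 0`, so
every other line may assume a solid one-particle cone. -/
theorem nonGaussian_forces_eta_of_stubs
    (h1 : ∀ (ρ : ℝ → ℝ) (S : CorrFamily 3), (∀ δ ∈ Set.Ioc (0:ℝ) 1, 0 < ρ δ) →
      HasPointwiseScalingLimit (criticalCorr 3) ρ S →
      (∀ n z, z ∉ NonCoincident 3 n → S n z = 0) → IsTranslationInvariant S → NineMirrorRP S)
    (h2 : ∀ (ρ : ℝ → ℝ) (Δ : ℝ) (S : CorrFamily 3), CruxHyp ρ Δ S → NineMirrorRP S → Δ = 1 / 2 →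
      ∀ (m : ℕ) (y : Fin m → EuclideanSpace ℝ (Fin 3)), Function.Injective y →
        ∀ n : EuclideanSpace ℝ (Fin 3), IsLatticeNormal n →
          ∀ u : EuclideanSpace ℝ (Fin 3),
            ((∀ i, inner ℝ u n < inner ℝ (y i) n) ∨ (∀ i, inner ℝ (y i) n < inner ℝ u n)) →
            InnerProductSpace.HarmonicAt
              (fun x : EuclideanSpace ℝ (Fin 3) => S (m + 1) (Fin.cons x y)) u)
    (h3 : ∀ (ρ : ℝ → ℝ) (S : CorrFamily 3), (∀ δ ∈ Set.Ioc (0:ℝ) 1, 0 < ρ δ) →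
      HasPointwiseScalingLimit (criticalCorr 3) ρ S →
      (∀ n z, z ∉ NonCoincident 3 n → S n z = 0) → IsTranslationInvariant S → NineMirrorRP S →
      AnalyticOffFinite S)
    (h4 : ∀ (ρ : ℝ → ℝ) (Δ : ℝ) (S : CorrFamily 3), CruxHyp ρ Δ S → Δ = 1 / 2 →
      (∀ (y : Fin 3 → EuclideanSpace ℝ (Fin 3)), Function.Injective y →
        ∀ n : EuclideanSpace ℝ (Fin 3), IsLatticeNormal n →
          ∀ u : EuclideanSpace ℝ (Fin 3),
            ((∀ i, inner ℝ u n < inner ℝ (y i) n) ∨ (∀ i, inner ℝ (y i) n < inner ℝ u n)) →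
            InnerProductSpace.HarmonicAt
              (fun x : EuclideanSpace ℝ (Fin 3) => S (3 + 1) (Fin.cons x y)) u) →
      (∀ (y : Fin 3 → EuclideanSpace ℝ (Fin 3)), Function.Injective y →
        ∃ F : Finset (EuclideanSpace ℝ (Fin 3)),
          AnalyticOnNhd ℝ (fun x : EuclideanSpace ℝ (Fin 3) => S (3 + 1) (Fin.cons x y))
            (Set.range y ∪ (F : Set (EuclideanSpace ℝ (Fin 3))))ᶜ) →
      ∀ z ∈ NonCoincident 3 4, limitConnectedFour S z = 0)
    {ρ : ℝ → ℝ} {Δ : ℝ} {S : CorrFamily 3} (hS : CruxHyp ρ Δ S) (hU4 : HasNontrivialU4 S) :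
    1 / 2 < Δ := by
  obtain ⟨hρ, hlim, _, hnd, _, hsc, _⟩ := id hS
  have hwin : Δ ∈ Set.Icc (1 / 2 : ℝ) 1 := delta_mem_Icc_of_hyp hρ hlim hnd hsc
  rcases eq_or_lt_of_le hwin.1 with heq | hlt
  · exfalso
    obtain ⟨z, hz, hne⟩ := hU4
    exact hne (edgeU4Vanishes_of_stubs h1 h2 h3 h4 hS heq.symm z hz)
  · exact hlt

/-- **Pure-logic composition (sorry-free).** STUB 1 gives nine-mirror OS positivity, STUB 3 the
analyticity layer. On the Gaussian locus `U₄ ≡ 0` the landed theorem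
`isRotationInvariant_of_gaussian` (Negative/AutomaticOrders) concludes. Otherwise
`HasNontrivialU4 S`; `Δ ∈ [1/2, 1]` (`delta_mem_Icc_of_hyp`); `Δ = 1/2` is impossible by STUBS
2 + 3 + 4 (`edgeU4Vanishes_of_stubs`), so `1/2 < Δ ≤ 1` and STUB 5 applies with the structure
of STUBS 1 and 3 in hand. -/
theorem crux_of_stubs
    (h1 : ∀ (ρ : ℝ → ℝ) (S : CorrFamily 3), (∀ δ ∈ Set.Ioc (0:ℝ) 1, 0 < ρ δ) →
      HasPointwiseScalingLimit (criticalCorr 3) ρ S →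
      (∀ n z, z ∉ NonCoincident 3 n → S n z = 0) → IsTranslationInvariant S → NineMirrorRP S)
    (h2 : ∀ (ρ : ℝ → ℝ) (Δ : ℝ) (S : CorrFamily 3), CruxHyp ρ Δ S → NineMirrorRP S → Δ = 1 / 2 →
      ∀ (m : ℕ) (y : Fin m → EuclideanSpace ℝ (Fin 3)), Function.Injective y →
        ∀ n : EuclideanSpace ℝ (Fin 3), IsLatticeNormal n →
          ∀ u : EuclideanSpace ℝ (Fin 3),
            ((∀ i, inner ℝ u n < inner ℝ (y i) n) ∨ (∀ i, inner ℝ (y i) n < inner ℝ u n)) →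
            InnerProductSpace.HarmonicAt
              (fun x : EuclideanSpace ℝ (Fin 3) => S (m + 1) (Fin.cons x y)) u)
    (h3 : ∀ (ρ : ℝ → ℝ) (S : CorrFamily 3), (∀ δ ∈ Set.Ioc (0:ℝ) 1, 0 < ρ δ) →
      HasPointwiseScalingLimit (criticalCorr 3) ρ S →
      (∀ n z, z ∉ NonCoincident 3 n → S n z = 0) → IsTranslationInvariant S → NineMirrorRP S →
      AnalyticOffFinite S)
    (h4 : ∀ (ρ : ℝ → ℝ) (Δ : ℝ) (S : CorrFamily 3), CruxHyp ρ Δ S → Δ = 1 / 2 →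
      (∀ (y : Fin 3 → EuclideanSpace ℝ (Fin 3)), Function.Injective y →
        ∀ n : EuclideanSpace ℝ (Fin 3), IsLatticeNormal n →
          ∀ u : EuclideanSpace ℝ (Fin 3),
            ((∀ i, inner ℝ u n < inner ℝ (y i) n) ∨ (∀ i, inner ℝ (y i) n < inner ℝ u n)) →
            InnerProductSpace.HarmonicAt
              (fun x : EuclideanSpace ℝ (Fin 3) => S (3 + 1) (Fin.cons x y)) u) →
      (∀ (y : Fin 3 → EuclideanSpace ℝ (Fin 3)), Function.Injective y →
        ∃ F : Finset (EuclideanSpace ℝ (Fin 3)),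
          AnalyticOnNhd ℝ (fun x : EuclideanSpace ℝ (Fin 3) => S (3 + 1) (Fin.cons x y))
            (Set.range y ∪ (F : Set (EuclideanSpace ℝ (Fin 3))))ᶜ) →
      ∀ z ∈ NonCoincident 3 4, limitConnectedFour S z = 0)
    (h5 : ∀ (ρ : ℝ → ℝ) (Δ : ℝ) (S : CorrFamily 3), CruxHyp ρ Δ S → 1 / 2 < Δ → Δ ≤ 1 →
      HasNontrivialU4 S → NineMirrorRP S → AnalyticOffFinite S → IsRotationInvariant S) :
    Crux := by
  rw [crux_iff]
  intro ρ Δ S hS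
  obtain ⟨hρ, hlim, hnorm, hnd, htr, hsc, hiso⟩ := id hS
  by_cases hU4 : HasNontrivialU4 S
  · -- the non-Gaussian branch: the edge is excluded, the interior is STUB 5
    have hwin : Δ ∈ Set.Icc (1 / 2 : ℝ) 1 := delta_mem_Icc_of_hyp hρ hlim hnd hsc
    have hlt : 1 / 2 < Δ := nonGaussian_forces_eta_of_stubs h1 h2 h3 h4 hS hU4
    have hRP : NineMirrorRP S := h1 ρ S hρ hlim hnorm htr
    exact h5 ρ Δ S hS hlt hwin.2 hU4 hRP (h3 ρ S hρ hlim hnorm htr hRP)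
  · -- the Gaussian locus: Wick at every even order (Aizenman–Newman dichotomy, landed theorem)
    have hU : ∀ z ∈ NonCoincident 3 4, limitConnectedFour S z = 0 := by
      intro z hz
      by_contra hne
      exact hU4 ⟨z, hz, hne⟩
    exact isRotationInvariant_of_gaussian hlim hnorm htr hiso hU

/-- **The skeleton theorem: the line closes the crux BY NAME.** Hypothesis-free; its only
non-whitelisted axiom is the `sorryAx` of the five declared stubs, fed to `crux_of_stubs`
(the def-free stub signatures are unfolded to the bundled shapes by `exact`, definitionally). -/
theorem RotationUpgradeFromTwoPoint_of :
    Summit.CriticalPhenomena.Ising3DConformalLimit.Theses.GaussianScaleMixture.RotationUpgradeFromTwoPoint :=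
  crux_of_stubs
    (fun ρ S hρ hlim hnorm htr => stub_nineMirrorRP ρ S hρ hlim hnorm htr)
    (fun ρ Δ S hS hRP hΔ => by
      obtain ⟨h1, h2, h3, h4, h5, h6, h7⟩ := hS
      exact stub_exteriorHarmonic ρ Δ S h1 h2 h3 h4 h5 h6 h7 hRP hΔ)
    (fun ρ S hρ hlim hnorm htr hRP => stub_analyticOffFinite ρ S hρ hlim hnorm htr hRP)
    (fun ρ Δ S hS hΔ => by
      obtain ⟨h1, h2, h3, h4, h5, h6, h7⟩ := hS
      exact stub_edgeBocherLiouville ρ Δ S h1 h2 h3 h4 h5 h6 h7 hΔ)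
    (fun ρ Δ S hS hlt hle hU4 hRP han => by
      obtain ⟨h1, h2, h3, h4, h5, h6, h7⟩ := hS
      exact stub_interiorRotationUpgrade ρ Δ S h1 h2 h3 h4 h5 h6 h7 hlt hle hU4 hRP han)

end Summit.CriticalPhenomena.Ising3DConformalLimit.Cruxes.RotationUpgradeFromTwoPoint.NullLaplacianEdgeGaussianity

end
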